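import Mathlib
import Literature.Analysis.FluidPDE.SuitableWeak
import Literature.Analysis.FluidPDE.Seregin2023.TypeIIEulerZoom
import Summits.NavierStokesRegularity.NavierStokesRegularity.Theses.EulerZoomLiouville
import Summits.NavierStokesRegularity.NavierStokesRegularity.Theorems.EulerZoomLiouvillePowerGaugeEulerLiouvilleAxisymNoSwirlDSS
import Summits.NavierStokesRegularity.NavierStokesRegularity.Theorems.EulerZoomLiouvillePowerGaugeEulerLiouvilleAxisymSwirlTransport
import HarnessLib

/-!
# The AXISYMMETRIC (with swirl) DISCRETELY SELF-SIMILAR stratum of the crux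
# `EulerZoomLiouville.PowerGaugeEulerLiouville` (route №10, item stmt-NavierStokesRegularity-19832) —
# every `ρ > 0`

Helper file (theorems only; `--supports stmt-NavierStokesRegularity-19832`). Seat ns-typeII-p3 (cell
ns-regularity-ideate §B, D-0081). Rungs C2 ∩ {axisymmetric} and C1 ∩ {axisymmetric} of the tenure planner's
in-window rung file `Cruxes/PowerGaugeEulerLiouville/Lines/rungC_window.lean` — the swirl is now ALLOWED.

THE STRATUM (`ae_eq_zero_of_gauge_of_axisym_dss`; binder forms `powerGaugeEulerLiouville_axisym_dss`,
`powerGaugeEulerLiouville_axisym_selfSimilar`). A member `(u, p, H, c)` of Seregin's power-gauged ancient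
Euler class (exponent `ρ > 0`; the crux's three hypotheses VERBATIM) which is a classical Euler solution on
the open slab with AXISYMMETRIC slices, DISCRETELY SELF-SIMILAR for the class scaling with a factor
`l > 1` (`u(τ,y) = l^{1+ρ} u(l^{2+ρ}τ, l y)`; exactly self-similar members are the case of every factor),
with — on every compact time interval `[s,t] ⊂ (−∞,0)` — bounded velocity and velocity gradient, the swirl
`Γ = r u_θ = swirl (u τ)` in `L^{2k}(ℝ³)` for ONE natural `k ≥ 1` with `2kρ ≠ 3`, and `η = ω_θ/r ∈ L²`,
all with uniform bounds, vanishes a.e. on the slab.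

THE TWO LEVERS are Euler TRANSPORT identities (not the local energy inequality):
(1) Kelvin: `D/Dt (r u_θ) = 0` ⇒ `∫ Γ(τ)^{2k}` is conserved (prequel `…AxisymSwirlTransport.lean`), while
the class scaling gives `Γ(τ,y) = l^{ρ} Γ(l^{2+ρ}τ, l y)`, `∫ Γ(τ)^{2k} = l^{2kρ−3} ∫ Γ(l^{2+ρ}τ)^{2k}`
(`integral_swirl_pow_sq_smul_comp_smul`); `l^{2kρ−3} ≠ 1` forces `Γ ≡ 0` — the member is SWIRL-FREE
(`swirl_slice_eq_zero_of_dss`); (2) Helmholtz / Ukhovskii–Yudovich: `D/Dt (ω_θ/r) = 0` for swirl-free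
flows ⇒ the swirl-free DSS stratum of the prequel `…AxisymNoSwirlDSS.lean` (`η ≡ 0`, `curl u ≡ 0`, and
the lead's `A`-gauge harmonic Liouville) finishes.

In print: Chae, CMP 273 (2007) «Note added» p. 6 treats EXACTLY self-similar axisymmetric blow-up with
`r V^θ ∈ L^{p₁} ∩ L^{p₂}` and `curl V ∈ H^m`, `m > 5/2`, closing with Ukhovskii–Yudovich's global
regularity; Constantin–Ignatova–Vicol (arXiv:2602.17570, 2026) §4 force `γ = 1/2` (outside the window)
for `C¹` axisymmetric profiles with nonzero swirl AT A STAGNATION POINT of the self-similar Lagrangian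
flow. Here: DSS (not only self-similar), one exponent for `Γ` and one for `η`, no stagnation-point or
`H^m` hypothesis, and the closing Liouville is the class's `A`-gauge. WHAT THIS IS NOT: not NS, not the
crux E and not rung C2 whole — a conditional stratum (classical regularity, bounded `u`/`∇u`,
`Γ ∈ L^{2k}`, `η ∈ L²` locally uniformly in time); non-axisymmetric DSS collapse is untouched. [folklore]
-/

noncomputable section

-- the summit and its single problem share the name `NavierStokesRegularity` (D-0017 nested layout)
set_option linter.dupNamespace false

open Set Function Filter Topology MeasureTheory Metric Module
open scoped NNReal ENNReal InnerProductSpace RealInnerProductSpace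

namespace Summit.NavierStokesRegularity.NavierStokesRegularity.Theorems.PowerGaugeEulerLiouville.AxisymNoSwirl

open Literature.Analysis Literature.Analysis.FluidPDE
open Summit.NavierStokesRegularity.NavierStokesRegularity.Theorems.PowerGaugeEulerLiouville

/-! ## The swirl under dilations -/

/-- `swirl (c • v(λ ·)) (y) = c λ⁻¹ · swirl v (λ y)` (`λ ≠ 0`). [folklore] -/
theorem swirl_smul_comp_smul (v : (EuclideanSpace ℝ (Fin 3)) → (EuclideanSpace ℝ (Fin 3))) (c : ℝ)
    {lam : ℝ} (hlam : lam ≠ 0) (y : (EuclideanSpace ℝ (Fin 3))) :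
    swirl (fun z : (EuclideanSpace ℝ (Fin 3)) => c • v (lam • z)) y = c * lam⁻¹ * swirl v (lam • y) := by
  simp only [swirl, PiLp.smul_apply, smul_eq_mul]
  field_simp

/-- **`∫ Γ_w^{2k} = (cλ⁻¹)^{2k} λ⁻³ ∫ Γ_v^{2k}`** for `w = c • v(λ ·)`, `λ > 0`, written with `(Γ^k)²`.
[folklore] -/
theorem integral_swirl_pow_sq_smul_comp_smul (v : (EuclideanSpace ℝ (Fin 3)) → (EuclideanSpace ℝ (Fin 3)))
    (c : ℝ) {lam : ℝ} (hlam : 0 < lam) (k : ℕ) :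
    ∫ y, (swirl (fun z : (EuclideanSpace ℝ (Fin 3)) => c • v (lam • z)) y ^ k) ^ 2 =
      (c * lam⁻¹) ^ (2 * k) * (lam ^ 3)⁻¹ * ∫ y, (swirl v y ^ k) ^ 2 := by
  have h1 : (fun y : (EuclideanSpace ℝ (Fin 3)) =>
      (swirl (fun z : (EuclideanSpace ℝ (Fin 3)) => c • v (lam • z)) y ^ k) ^ 2) =
      fun y => (c * lam⁻¹) ^ (2 * k) * (fun z : (EuclideanSpace ℝ (Fin 3)) => (swirl v z ^ k) ^ 2) (lam • y) := by
    funext y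
    rw [swirl_smul_comp_smul v c hlam.ne' y]
    ring
  rw [h1, integral_const_mul, Measure.integral_comp_smul volume
      (fun z : (EuclideanSpace ℝ (Fin 3)) => (swirl v z ^ k) ^ 2) lam,
    finrank_euclideanSpace_fin, abs_of_pos (inv_pos.2 (pow_pos hlam 3)), smul_eq_mul]
  ring

/-- The scaling factor of `∫ Γ^{2k}` under the class scaling: `(l^{1+ρ} l⁻¹)^{2k} (l³)⁻¹ = l^{2kρ − 3}`.
[folklore] -/
theorem swirl_scaling_factor_eq {l ρ : ℝ} (hl : 0 < l) (k : ℕ) :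
    (l ^ (1 + ρ) * l⁻¹) ^ (2 * k) * (l ^ (3 : ℕ))⁻¹ = l ^ (2 * (k : ℝ) * ρ - 3) := by
  have h1 : l ^ (1 + ρ) * l⁻¹ = l ^ ρ := by
    rw [Real.rpow_add hl, Real.rpow_one]; field_simp
  rw [h1, ← Real.rpow_natCast (l ^ ρ), ← Real.rpow_mul hl.le, ← Real.rpow_natCast l 3,
    ← Real.rpow_neg hl.le, ← Real.rpow_add hl]
  congr 1
  push_cast
  ring

/-- For `l > 1` and a nonzero exponent, `l^e ≠ 1`. [folklore] -/
theorem rpow_ne_one_of_one_lt {l e : ℝ} (hl : 1 < l) (he : e ≠ 0) : l ^ e ≠ 1 := by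
  rcases lt_or_gt_of_ne he with h | h
  · exact (Real.rpow_lt_one_of_one_lt_of_neg hl h).ne
  · exact (Real.one_lt_rpow hl h).ne'

/-! ## DSS axisymmetric members are swirl-free -/

/-- **`∫ Γ(τ)^{2k} = 0` for a DSS axisymmetric classical Euler flow with `2kρ ≠ 3`**: the class scaling
multiplies `∫ Γ^{2k}` by `l^{2kρ−3} ≠ 1` between the times `l^{2+ρ}τ` and `τ`, transport conserves it.
[folklore] -/
theorem integral_swirl_pow_sq_eq_zero_of_dss {ρ : ℝ} (hρ : 0 < ρ)
    {u : ℝ → (EuclideanSpace ℝ (Fin 3)) → (EuclideanSpace ℝ (Fin 3))} {p : ℝ → (EuclideanSpace ℝ (Fin 3)) → ℝ}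
    (hns : IsClassicalNSSolutionOn (Iio 0) 0 0 u p)
    (hax : ∀ τ : ℝ, τ < 0 → IsAxisymmetric (u τ))
    {l : ℝ} (hl : 1 < l)
    (hdss : ∀ τ : ℝ, τ < 0 → ∀ y, u τ y = (l ^ (1 + ρ)) • u ((l ^ (2 + ρ)) * τ) (l • y))
    (hbdd : ∀ s t : ℝ, s < t → t < 0 → ∃ B : ℝ, ∀ τ ∈ Icc s t, ∀ y,
      ‖u τ y‖ ≤ B ∧ ‖fderiv ℝ (u τ) y‖ ≤ B)
    {k : ℕ} (hk : 2 * (k : ℝ) * ρ ≠ 3)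
    (hLk : ∀ s t : ℝ, s < t → t < 0 → ∃ N : ℝ, ∀ τ ∈ Icc s t,
      Integrable (fun y => (swirl (u τ) y ^ k) ^ 2) ∧ ∫ y, (swirl (u τ) y ^ k) ^ 2 ≤ N)
    {τ : ℝ} (hτ : τ < 0) : ∫ y, (swirl (u τ) y ^ k) ^ 2 = 0 := by
  have hl0 : 0 < l := zero_lt_one.trans hl
  have hL : 1 < l ^ (2 + ρ) := Real.one_lt_rpow hl (by linarith)
  set τ' : ℝ := l ^ (2 + ρ) * τ with hτ'
  have hτ'τ : τ' < τ := by
    have : τ' - τ = (l ^ (2 + ρ) - 1) * τ := by rw [hτ']; ring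
    nlinarith
  have hτ'0 : τ' < 0 := hτ'τ.trans hτ
  -- scaling
  have hfun : u τ = fun y => (l ^ (1 + ρ)) • u τ' (l • y) := funext fun y => hdss τ hτ y
  have hscale : ∫ y, (swirl (u τ) y ^ k) ^ 2 =
      l ^ (2 * (k : ℝ) * ρ - 3) * ∫ y, (swirl (u τ') y ^ k) ^ 2 := by
    rw [hfun, integral_swirl_pow_sq_smul_comp_smul (u τ') _ hl0 k, swirl_scaling_factor_eq hl0 k]
  -- transport
  obtain ⟨B, hB⟩ := hbdd τ' τ hτ'τ hτ
  obtain ⟨N, hN⟩ := hLk τ' τ hτ'τ hτ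
  have hcons := integral_swirl_pow_eq_of_classical hns hax k hτ'τ hτ hB hN
  -- combine: `(l^{2kρ-3} - 1) I = 0`
  rw [hcons] at hscale
  have hne : l ^ (2 * (k : ℝ) * ρ - 3) ≠ 1 := rpow_ne_one_of_one_lt hl (sub_ne_zero.2 hk)
  have hI : (l ^ (2 * (k : ℝ) * ρ - 3) - 1) * ∫ y, (swirl (u τ') y ^ k) ^ 2 = 0 := by linarith
  rcases mul_eq_zero.1 hI with h | h
  · exact absurd (sub_eq_zero.1 h) hne
  · rw [hcons, h]

/-- **DSS axisymmetric classical members with `Γ ∈ L^{2k}`, `k ≥ 1`, `2kρ ≠ 3`, are SWIRL-FREE.**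
[folklore] -/
theorem swirl_slice_eq_zero_of_dss {ρ : ℝ} (hρ : 0 < ρ)
    {u : ℝ → (EuclideanSpace ℝ (Fin 3)) → (EuclideanSpace ℝ (Fin 3))} {p : ℝ → (EuclideanSpace ℝ (Fin 3)) → ℝ}
    (hns : IsClassicalNSSolutionOn (Iio 0) 0 0 u p)
    (hax : ∀ τ : ℝ, τ < 0 → IsAxisymmetric (u τ))
    {l : ℝ} (hl : 1 < l)
    (hdss : ∀ τ : ℝ, τ < 0 → ∀ y, u τ y = (l ^ (1 + ρ)) • u ((l ^ (2 + ρ)) * τ) (l • y))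
    (hbdd : ∀ s t : ℝ, s < t → t < 0 → ∃ B : ℝ, ∀ τ ∈ Icc s t, ∀ y,
      ‖u τ y‖ ≤ B ∧ ‖fderiv ℝ (u τ) y‖ ≤ B)
    {k : ℕ} (hk1 : 1 ≤ k) (hk : 2 * (k : ℝ) * ρ ≠ 3)
    (hLk : ∀ s t : ℝ, s < t → t < 0 → ∃ N : ℝ, ∀ τ ∈ Icc s t,
      Integrable (fun y => (swirl (u τ) y ^ k) ^ 2) ∧ ∫ y, (swirl (u τ) y ^ k) ^ 2 ≤ N)
    {τ : ℝ} (hτ : τ < 0) : HasNoSwirl (u τ) := by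
  have h0 := integral_swirl_pow_sq_eq_zero_of_dss hρ hns hax hl hdss hbdd hk hLk hτ
  have hcont : Continuous (fun y => (swirl (u τ) y ^ k) ^ 2) :=
    ((contDiff_swirl (hns.contDiff_velocity hτ)).continuous.pow k).pow 2
  obtain ⟨N, hN⟩ := hLk (2 * τ) τ (by linarith) hτ
  have hint : Integrable (fun y => (swirl (u τ) y ^ k) ^ 2) := (hN τ ⟨by linarith, le_rfl⟩).1
  have hae : (fun y => (swirl (u τ) y ^ k) ^ 2) =ᵐ[volume] 0 :=
    (integral_eq_zero_iff_of_nonneg (fun y => sq_nonneg _) hint).1 h0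
  have hzero : (fun y => (swirl (u τ) y ^ k) ^ 2) = 0 :=
    Continuous.ae_eq_iff_eq volume hcont continuous_const |>.1 hae
  intro y
  have := congrFun hzero y
  have hk0 : k ≠ 0 := by omega
  simpa [hk0] using this

/-! ## The axisymmetric DSS stratum -/

/-- **The axisymmetric DSS stratum of the crux `PowerGaugeEulerLiouville`** (every `ρ > 0`; rung C2 ∩
{axisymmetric} of `Lines/rungC_window.lean`, conditional): a member of the power-gauged ancient Euler
class that is classical on the open slab, has AXISYMMETRIC slices (swirl allowed), is discretely
self-similar with factor `l > 1`, and has on compact time intervals bounded `u`/`∇u`, `Γ = r u_θ ∈ L^{2k}`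
for one `k ≥ 1` with `2kρ ≠ 3`, and `η = ω_θ/r ∈ L²` (uniform bounds), vanishes a.e. — Kelvin's
`D/Dt(r u_θ) = 0` kills the swirl, then the swirl-free DSS stratum applies. [folklore] -/
theorem ae_eq_zero_of_gauge_of_axisym_dss {ρ : ℝ} (hρ : 0 < ρ)
    {u : ℝ → (EuclideanSpace ℝ (Fin 3)) → (EuclideanSpace ℝ (Fin 3))} {p : ℝ → (EuclideanSpace ℝ (Fin 3)) → ℝ}
    {H : ℝ → (EuclideanSpace ℝ (Fin 3)) → (EuclideanSpace ℝ (Fin 3)) →L[ℝ] (EuclideanSpace ℝ (Fin 3))} {c : ℝ≥0}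
    (hH : HasWeakSpatialGradientOn (slab (EuclideanSpace ℝ (Fin 3)) (Iio 0) isOpen_Iio) u H)
    (hc : ∀ a : ℝ, 0 < a → ENNReal.ofReal (a ^ (2 * ρ)) * cknA a (0 : ℝ × (EuclideanSpace ℝ (Fin 3))) u +
        ENNReal.ofReal (a ^ ρ) * cknE a (0 : ℝ × (EuclideanSpace ℝ (Fin 3))) H +
        ENNReal.ofReal (a ^ (2 * ρ)) * cknD a (0 : ℝ × (EuclideanSpace ℝ (Fin 3))) p ≤ (c : ℝ≥0∞))
    (hns : IsClassicalNSSolutionOn (Iio 0) 0 0 u p)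
    (hax : ∀ τ : ℝ, τ < 0 → IsAxisymmetric (u τ))
    {l : ℝ} (hl : 1 < l)
    (hdss : ∀ τ : ℝ, τ < 0 → ∀ y, u τ y = (l ^ (1 + ρ)) • u ((l ^ (2 + ρ)) * τ) (l • y))
    (hbdd : ∀ s t : ℝ, s < t → t < 0 → ∃ B : ℝ, ∀ τ ∈ Icc s t, ∀ y,
      ‖u τ y‖ ≤ B ∧ ‖fderiv ℝ (u τ) y‖ ≤ B)
    {k : ℕ} (hk1 : 1 ≤ k) (hk : 2 * (k : ℝ) * ρ ≠ 3)
    (hLk : ∀ s t : ℝ, s < t → t < 0 → ∃ N : ℝ, ∀ τ ∈ Icc s t,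
      Integrable (fun y => (swirl (u τ) y ^ k) ^ 2) ∧ ∫ y, (swirl (u τ) y ^ k) ^ 2 ≤ N)
    (hL2 : ∀ s t : ℝ, s < t → t < 0 → ∃ N : ℝ, ∀ τ ∈ Icc s t,
      Integrable (fun y => angVortQuot (u τ) y ^ 2) ∧ ∫ y, angVortQuot (u τ) y ^ 2 ≤ N) :
    uncurry u =ᵐ[volume.restrict (Iio (0 : ℝ) ×ˢ (univ : Set (EuclideanSpace ℝ (Fin 3))))] 0 :=
  ae_eq_zero_of_gauge_of_axisymNoSwirl_dss hρ hH hc hns hax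
    (fun _ hτ => swirl_slice_eq_zero_of_dss hρ hns hax hl hdss hbdd hk1 hk hLk hτ) hl hdss hbdd hL2

/-- **The stratum in the crux's binder shape**: the crux `PowerGaugeEulerLiouville` VERBATIM with the extra
hypotheses «classical on the open slab, axisymmetric slices, DSS with factor `l > 1`, bounded `u`/`∇u`,
`(r u_θ)^k ∈ L²` for one `k ≥ 1` with `2kρ ≠ 3` and `ω_θ/r ∈ L²` on compact time intervals».
[folklore] -/
theorem powerGaugeEulerLiouville_axisym_dss :
    ∀ ρ : ℝ, 0 < ρ → ∀ (u : ℝ → EuclideanSpace ℝ (Fin 3) → EuclideanSpace ℝ (Fin 3))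
      (p : ℝ → EuclideanSpace ℝ (Fin 3) → ℝ)
      (H : ℝ → EuclideanSpace ℝ (Fin 3) → EuclideanSpace ℝ (Fin 3) →L[ℝ] EuclideanSpace ℝ (Fin 3)) (c : ℝ≥0)
      (l : ℝ) (k : ℕ),
      IsSuitableWeakSolutionOn (slab (EuclideanSpace ℝ (Fin 3)) (Set.Iio 0) isOpen_Iio) 0 0 u p →
      HasWeakSpatialGradientOn (slab (EuclideanSpace ℝ (Fin 3)) (Set.Iio 0) isOpen_Iio) u H →
      (∀ a : ℝ, 0 < a → ENNReal.ofReal (a ^ (2 * ρ)) * cknA a (0 : ℝ × EuclideanSpace ℝ (Fin 3)) u +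
        ENNReal.ofReal (a ^ ρ) * cknE a (0 : ℝ × EuclideanSpace ℝ (Fin 3)) H +
        ENNReal.ofReal (a ^ (2 * ρ)) * cknD a (0 : ℝ × EuclideanSpace ℝ (Fin 3)) p ≤ (c : ℝ≥0∞)) →
      IsClassicalNSSolutionOn (Set.Iio 0) 0 0 u p →
      (∀ τ : ℝ, τ < 0 → IsAxisymmetric (u τ)) →
      1 < l →
      (∀ τ : ℝ, τ < 0 → ∀ y, u τ y = (l ^ (1 + ρ)) • u ((l ^ (2 + ρ)) * τ) (l • y)) →
      (∀ s t : ℝ, s < t → t < 0 → ∃ B : ℝ, ∀ τ ∈ Set.Icc s t, ∀ y,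
        ‖u τ y‖ ≤ B ∧ ‖fderiv ℝ (u τ) y‖ ≤ B) →
      1 ≤ k → 2 * (k : ℝ) * ρ ≠ 3 →
      (∀ s t : ℝ, s < t → t < 0 → ∃ N : ℝ, ∀ τ ∈ Set.Icc s t,
        Integrable (fun y => (swirl (u τ) y ^ k) ^ 2) ∧ ∫ y, (swirl (u τ) y ^ k) ^ 2 ≤ N) →
      (∀ s t : ℝ, s < t → t < 0 → ∃ N : ℝ, ∀ τ ∈ Set.Icc s t,
        Integrable (fun y => angVortQuot (u τ) y ^ 2) ∧ ∫ y, angVortQuot (u τ) y ^ 2 ≤ N) →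
      Function.uncurry u =ᵐ[volume.restrict (Set.Iio (0 : ℝ) ×ˢ (Set.univ : Set (EuclideanSpace ℝ (Fin 3))))] 0 :=
  fun _ hρ _ _ _ _ _ _ _ hH hc hns hax hl hdss hbdd hk1 hk hLk hL2 =>
    ae_eq_zero_of_gauge_of_axisym_dss hρ hH hc hns hax hl hdss hbdd hk1 hk hLk hL2

/-- **Rung C1 ∩ {axisymmetric} (conditional): no exactly self-similar AXISYMMETRIC Euler collapse in the
power-gauged class**, every `ρ > 0`, for classical members with bounded `u`/`∇u`, `(r u_θ)^k ∈ L²` (one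
`k ≥ 1`, `2kρ ≠ 3`) and `ω_θ/r ∈ L²` on compact time intervals — swirl allowed, no stagnation-point or
outgoing hypothesis. [folklore] -/
theorem powerGaugeEulerLiouville_axisym_selfSimilar :
    ∀ ρ : ℝ, 0 < ρ → ∀ (u : ℝ → EuclideanSpace ℝ (Fin 3) → EuclideanSpace ℝ (Fin 3))
      (p : ℝ → EuclideanSpace ℝ (Fin 3) → ℝ)
      (H : ℝ → EuclideanSpace ℝ (Fin 3) → EuclideanSpace ℝ (Fin 3) →L[ℝ] EuclideanSpace ℝ (Fin 3)) (c : ℝ≥0)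
      (V : EuclideanSpace ℝ (Fin 3) → EuclideanSpace ℝ (Fin 3)) (k : ℕ),
      IsSuitableWeakSolutionOn (slab (EuclideanSpace ℝ (Fin 3)) (Set.Iio 0) isOpen_Iio) 0 0 u p →
      HasWeakSpatialGradientOn (slab (EuclideanSpace ℝ (Fin 3)) (Set.Iio 0) isOpen_Iio) u H →
      (∀ a : ℝ, 0 < a → ENNReal.ofReal (a ^ (2 * ρ)) * cknA a (0 : ℝ × EuclideanSpace ℝ (Fin 3)) u +
        ENNReal.ofReal (a ^ ρ) * cknE a (0 : ℝ × EuclideanSpace ℝ (Fin 3)) H +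
        ENNReal.ofReal (a ^ (2 * ρ)) * cknD a (0 : ℝ × EuclideanSpace ℝ (Fin 3)) p ≤ (c : ℝ≥0∞)) →
      IsClassicalNSSolutionOn (Set.Iio 0) 0 0 u p →
      (∀ τ : ℝ, τ < 0 → IsAxisymmetric (u τ)) →
      (∀ τ : ℝ, τ < 0 → ∀ y : EuclideanSpace ℝ (Fin 3),
        u τ y = ((-τ) ^ (-((1 + ρ) / (2 + ρ)))) • V (((-τ) ^ (-(1 / (2 + ρ)))) • y)) →
      (∀ s t : ℝ, s < t → t < 0 → ∃ B : ℝ, ∀ τ ∈ Set.Icc s t, ∀ y,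
        ‖u τ y‖ ≤ B ∧ ‖fderiv ℝ (u τ) y‖ ≤ B) →
      1 ≤ k → 2 * (k : ℝ) * ρ ≠ 3 →
      (∀ s t : ℝ, s < t → t < 0 → ∃ N : ℝ, ∀ τ ∈ Set.Icc s t,
        Integrable (fun y => (swirl (u τ) y ^ k) ^ 2) ∧ ∫ y, (swirl (u τ) y ^ k) ^ 2 ≤ N) →
      (∀ s t : ℝ, s < t → t < 0 → ∃ N : ℝ, ∀ τ ∈ Set.Icc s t,
        Integrable (fun y => angVortQuot (u τ) y ^ 2) ∧ ∫ y, angVortQuot (u τ) y ^ 2 ≤ N) →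
      Function.uncurry u =ᵐ[volume.restrict (Set.Iio (0 : ℝ) ×ˢ (Set.univ : Set (EuclideanSpace ℝ (Fin 3))))] 0 :=
  fun _ hρ _ _ _ _ _ _ _ hH hc hns hax hss hbdd hk1 hk hLk hL2 =>
    ae_eq_zero_of_gauge_of_axisym_dss hρ hH hc hns hax one_lt_two (dss_of_selfSimilar hρ hss two_pos)
      hbdd hk1 hk hLk hL2

/-- The axisymmetric DSS stratum is a literal sub-case of the route decl `PowerGaugeEulerLiouville`
(strictly inside the crux E, never summit-strength). [folklore] -/
theorem axisym_dss_of_powerGaugeEulerLiouville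
    (hE : Summit.NavierStokesRegularity.NavierStokesRegularity.Theses.EulerZoomLiouville.PowerGaugeEulerLiouville) :
    ∀ ρ : ℝ, 0 < ρ → ∀ (u : ℝ → EuclideanSpace ℝ (Fin 3) → EuclideanSpace ℝ (Fin 3))
      (p : ℝ → EuclideanSpace ℝ (Fin 3) → ℝ)
      (H : ℝ → EuclideanSpace ℝ (Fin 3) → EuclideanSpace ℝ (Fin 3) →L[ℝ] EuclideanSpace ℝ (Fin 3)) (c : ℝ≥0)
      (l : ℝ),
      IsSuitableWeakSolutionOn (slab (EuclideanSpace ℝ (Fin 3)) (Set.Iio 0) isOpen_Iio) 0 0 u p →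
      HasWeakSpatialGradientOn (slab (EuclideanSpace ℝ (Fin 3)) (Set.Iio 0) isOpen_Iio) u H →
      (∀ a : ℝ, 0 < a → ENNReal.ofReal (a ^ (2 * ρ)) * cknA a (0 : ℝ × EuclideanSpace ℝ (Fin 3)) u +
        ENNReal.ofReal (a ^ ρ) * cknE a (0 : ℝ × EuclideanSpace ℝ (Fin 3)) H +
        ENNReal.ofReal (a ^ (2 * ρ)) * cknD a (0 : ℝ × EuclideanSpace ℝ (Fin 3)) p ≤ (c : ℝ≥0∞)) →
      IsClassicalNSSolutionOn (Set.Iio 0) 0 0 u p →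
      (∀ τ : ℝ, τ < 0 → IsAxisymmetric (u τ)) →
      1 < l →
      (∀ τ : ℝ, τ < 0 → ∀ y, u τ y = (l ^ (1 + ρ)) • u ((l ^ (2 + ρ)) * τ) (l • y)) →
      Function.uncurry u =ᵐ[volume.restrict (Set.Iio (0 : ℝ) ×ˢ (Set.univ : Set (EuclideanSpace ℝ (Fin 3))))] 0 :=
  fun ρ hρ u p H c _ hsw hH hc _ _ _ _ => hE ρ hρ u p H c hsw hH hc

end Summit.NavierStokesRegularity.NavierStokesRegularity.Theorems.PowerGaugeEulerLiouville.AxisymNoSwirl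

end
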